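import Summits.NavierStokesRegularity.NavierStokesRegularity.Theorems.PerpetualPumpAveragedTypeIBlowupPreviousPairRates

/-!
# Crux `PerpetualPump.AveragedTypeIBlowup` (stmt-NavierStokesRegularity-1835), line `Sketch`:
# stub `previousPair` — a priori estimates inside the bootstrap tube, IV (the previous carrier)

Continuation of `…PreviousPairRates` (same section variables; independent of `…PreviousPairDecay/Dump`). The previous carrier obeys
`bp' = -κ bp - κ wp² + G`, `G = κ(wl² - εb bp wp) + e0`; by the constant-rate Duhamel formula
(`previousPair_duhamel`) `bp(σ) = e^{-κσ}(bp(0) - I₁(σ)) + e^{-κσ}∫₀^σ e^{κu} G` with the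
weighted dump `I₁(σ) = ∫₀^σ e^{κu} κ wp²`.

* `prevPair_m0` — the carrier majorant `m0 ≤ μ + 3`;
* `prevPair_G_le` — `|G| ≤ κ(ω² + η(μ+3)) + (9/20)κ εb (1 + wp²)`;
* `prevPair_bp_duhamel` — `|bp(σ) - e^{-κσ}(bp(0) - I₁(σ))| ≤ 7/125`;
* `prevPair_bp_upper` — `bp ≤ 77/100` on `[0, s]` (registered sub-goal
  `stub_prevPairCarrier`).

Continued in `…PreviousPairRelax` (relaxation after `σI`, lower bound, the bond after `σI`).

## References

T. Tao, *Finite time blowup for an averaged three-dimensional Navier–Stokes equation*, J. Amer.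
Math. Soc. 29 (2016), §5–6; folklore ODE calculus.
-/

noncomputable section

-- the summit namespace `…NavierStokesRegularity.NavierStokesRegularity…` is the tree convention
set_option linter.dupNamespace false
-- every lemma of this file lives inside one `variable … include` context (the bootstrap tube);
-- not every lemma uses every bundled hypothesis
set_option linter.unusedSectionVars false

open MeasureTheory Set Filter Topology

namespace Summit.NavierStokesRegularity.NavierStokesRegularity.Theorems.PerpetualPumpAveragedTypeIBlowup

section Tube

variable {bp wp b m0 m1 wl e0 e1 : ℝ → ℝ} {B Λ κ q θ η εb ω μ σI T s : ℝ}

variable (hκq : 4 / 5 ≤ κ ∧ κ ≤ 1 ∧ 1 ≤ q ∧ q ≤ 21 / 20)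
  (hsm : 0 ≤ η ∧ 0 < εb ∧ 10 * εb ≤ ω ∧ ω ≤ 1 / 100 ∧ 0 ≤ μ ∧
    η * (μ + 2 * Real.sqrt B) ≤ ω / 10 ∧ η * μ ≤ 1 / 20 ∧ 1 / 2 ≤ θ ∧ θ ≤ 1)
  (hBT : 1000 ≤ B ∧ 0 < σI ∧ σI ≤ 3 ∧ 0 < T ∧ T ≤ 10)
  (hΛ : 100 ≤ Λ ∧ Λ ≤ B * (1 - Real.exp (-σI)) ∧
    11 * Real.sqrt B * Real.exp (-(κ * Λ / 3)) ≤ ω)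
  (hcont : ContinuousOn bp (Icc 0 T) ∧ ContinuousOn wp (Icc 0 T) ∧ ContinuousOn b (Icc 0 T) ∧
    ContinuousOn m0 (Icc 0 T) ∧ ContinuousOn m1 (Icc 0 T) ∧ ContinuousOn wl (Icc 0 T) ∧
    ContinuousOn e0 (Icc 0 T) ∧ ContinuousOn e1 (Icc 0 T))
  (hode : (∀ σ ∈ Ioo 0 T, HasDerivAt bp
      (κ * (-(bp σ) - (wp σ) ^ 2 + (wl σ) ^ 2 - εb * bp σ * wp σ) + e0 σ) σ) ∧
    (∀ σ ∈ Ioo 0 T, HasDerivAt wp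
      (κ * (wp σ * (bp σ - b σ / q - 1) + εb * (bp σ) ^ 2) + e1 σ) σ))
  (herr : (∀ σ ∈ Icc 0 T, |e0 σ| ≤ η * κ * m0 σ) ∧ (∀ σ ∈ Icc 0 T, |e1 σ| ≤ η * κ * m1 σ) ∧
    (∀ σ ∈ Icc 0 T, 0 ≤ m0 σ ∧ m0 σ ≤ m0 0 * Real.exp (-(θ * κ * σ)) +
      κ * ∫ u in (0 : ℝ)..σ, Real.exp (-(θ * κ * (σ - u))) *
        |-(wp u) ^ 2 + (wl u) ^ 2 - εb * bp u * wp u|) ∧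
    (∀ σ ∈ Icc 0 T, 0 ≤ m1 σ ∧ m1 σ ≤ m1 0 * Real.exp (-(θ * κ * σ)) +
      κ * ∫ u in (0 : ℝ)..σ, Real.exp (-(θ * κ * (σ - u))) *
        |wp u * (bp u - b u / q) + εb * (bp u) ^ 2|))
  (henv : (∀ σ ∈ Icc 0 T, |wl σ| ≤ ω) ∧
    (∀ σ ∈ Icc 0 (min T σI), B * Real.exp (-σ) - 3 ≤ b σ) ∧
    (∀ σ ∈ Icc 0 T, -(1 / 2) ≤ b σ ∧ b σ ≤ B + 3))
  (hini : q ^ 4 / 2 - 3 / 20 ≤ bp 0 ∧ bp 0 ≤ q ^ 4 / 2 + 1 / 10 ∧ 0 ≤ wp 0 ∧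
    q ^ 3 * B - 1 ≤ (wp 0) ^ 2 ∧ (wp 0) ^ 2 ≤ q ^ 3 * B + 1 ∧ m0 0 ≤ μ ∧ m1 0 ≤ μ)
  (hs : s ∈ Icc 0 T)
  (hT : ∀ σ ∈ Icc 0 s, -(1 / 2) ≤ bp σ ∧ bp σ ≤ 9 / 10 ∧ (σ ≤ σI ∨ bp σ ≤ 2 / 5) ∧
    m1 σ ≤ μ + 3 * Real.sqrt B ∧ κ * ∫ u in (0 : ℝ)..σ, (wp u) ^ 2 ≤ 1)

include hκq hsm hBT hΛ hcont hode herr henv hini hs hT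

/-- **Carrier majorant.** `m0 ≤ μ + 3` on `[0, s]`
(`|−wp² + wl² − εb bp wp| ≤ 2wp² + 1/1000`, `κ∫wp² ≤ 1`). [folklore] -/
theorem prevPair_m0 {u : ℝ} (hu : u ∈ Icc 0 s) : m0 u ≤ μ + 3 := by
  obtain ⟨-, -, hwpc, hbpc⟩ := prevPair_cont hκq hsm hBT hΛ hcont hode herr henv hini hs hT
  obtain ⟨hκ0, hκ1, -, -⟩ := hκq
  obtain ⟨-, hεb, hεω, hω, hμ, -, -, hθ1, -⟩ := hsm
  obtain ⟨-, -, -, -, hT10⟩ := hBT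
  obtain ⟨-, -, hm0, -⟩ := herr
  obtain ⟨hwl, -, -⟩ := henv
  have hκ : 0 < κ := by linarith
  have huT : u ∈ Icc 0 T := ⟨hu.1, hu.2.trans hs.2⟩
  have hwlc : ContinuousOn wl (Icc 0 s) := hcont.2.2.2.2.2.1.mono (Icc_subset_Icc_right hs.2)
  have hm00 : 0 ≤ m0 0 := (hm0 0 ⟨le_rfl, hs.1.trans hs.2⟩).1
  have hexp : Real.exp (-(θ * κ * u)) ≤ 1 :=
    Real.exp_le_one_iff.2 (by
      nlinarith only [mul_nonneg (mul_nonneg (by linarith only [hθ1] : (0:ℝ) ≤ θ) hκ.le) hu.1])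
  have hA : m0 0 * Real.exp (-(θ * κ * u)) ≤ μ :=
    (mul_le_of_le_one_right hm00 hexp).trans hini.2.2.2.2.2.1
  have hsub : Icc 0 u ⊆ Icc 0 s := Icc_subset_Icc_right hu.2
  have hpt : ∀ v ∈ Icc 0 u, Real.exp (-(θ * κ * (u - v))) *
      |-(wp v) ^ 2 + (wl v) ^ 2 - εb * bp v * wp v| ≤ 2 * wp v ^ 2 + 1 / 1000 := by
    intro v hv
    have hvS : v ∈ Icc 0 s := hsub hv
    obtain ⟨hbp1, hbp2, -, -, -⟩ := hT v hvS
    have hwlv := hwl v ⟨hvS.1, hvS.2.trans hs.2⟩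
    have he : Real.exp (-(θ * κ * (u - v))) ≤ 1 :=
      Real.exp_le_one_iff.2 (by
        nlinarith only [mul_nonneg (mul_nonneg (by linarith only [hθ1] : (0:ℝ) ≤ θ) hκ.le)
          (by linarith only [hv.2] : (0:ℝ) ≤ u - v)])
    have h1 : |-(wp v) ^ 2 + (wl v) ^ 2 - εb * bp v * wp v| ≤
        wp v ^ 2 + wl v ^ 2 + εb * |bp v| * |wp v| := by
      have := abs_add_le (-(wp v) ^ 2 + (wl v) ^ 2) (-(εb * bp v * wp v))
      have h2 : |-(wp v) ^ 2 + (wl v) ^ 2| ≤ wp v ^ 2 + wl v ^ 2 := by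
        rw [abs_le]; constructor <;> nlinarith only [sq_nonneg (wp v), sq_nonneg (wl v)]
      have h3 : |-(εb * bp v * wp v)| = εb * |bp v| * |wp v| := by
        rw [abs_neg, abs_mul, abs_mul, abs_of_pos hεb]
      rw [sub_eq_add_neg]; linarith only [this, h2, h3]
    have h2 : wl v ^ 2 ≤ ω ^ 2 := by nlinarith only [abs_le.1 hwlv, sq_abs (wl v)]
    have h3 : |bp v| ≤ 9 / 10 := abs_le.2 ⟨by linarith only [hbp1], hbp2⟩
    have h4 : |wp v| ≤ (1 + wp v ^ 2) / 2 := by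
      nlinarith only [sq_nonneg (|wp v| - 1), sq_abs (wp v)]
    have h5 : εb * |bp v| * |wp v| ≤ εb * (9 / 10) * ((1 + wp v ^ 2) / 2) :=
      mul_le_mul (mul_le_mul_of_nonneg_left h3 hεb.le) h4 (abs_nonneg _) (by positivity)
    have hε : εb ≤ 1 / 1000 := by linarith only [hεω, hω]
    have hω2 : ω ^ 2 ≤ 1 / 10000 := by nlinarith only [hω, hεb, hεω]
    have h6 : εb * (9 / 10) * ((1 + wp v ^ 2) / 2) ≤ 1 / 1000 * (9 / 10) * ((1 + wp v ^ 2) / 2) :=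
      mul_le_mul_of_nonneg_right (mul_le_mul_of_nonneg_right hε (by norm_num)) (by positivity)
    calc _ ≤ |-(wp v) ^ 2 + (wl v) ^ 2 - εb * bp v * wp v| :=
          mul_le_of_le_one_left (abs_nonneg _) he
      _ ≤ _ := by linarith only [h1, h2, h5, h6, hω2, sq_nonneg (wp v)]
  have hIc : ContinuousOn (fun v => Real.exp (-(θ * κ * (u - v))) *
      |-(wp v) ^ 2 + (wl v) ^ 2 - εb * bp v * wp v|) (Icc 0 u) := by
    refine (Continuous.continuousOn (by fun_prop)).mul ?_
    exact ((((hwpc.mono hsub).pow 2).neg.add ((hwlc.mono hsub).pow 2)).sub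
      ((continuousOn_const.mul (hbpc.mono hsub)).mul (hwpc.mono hsub))).abs
  have hwI : IntervalIntegrable (fun v => wp v ^ 2) volume 0 u :=
    ((hwpc.mono hsub).pow 2).intervalIntegrable_of_Icc hu.1
  have hint := intervalIntegral.integral_mono_on hu.1
    (hIc.intervalIntegrable_of_Icc (μ := volume) hu.1)
    ((hwI.const_mul 2).add intervalIntegrable_const) hpt
  rw [intervalIntegral.integral_add (hwI.const_mul 2) intervalIntegrable_const,
    intervalIntegral.integral_const_mul, intervalIntegral.integral_const, smul_eq_mul,
    sub_zero] at hint
  have hm0le := (hm0 u huT).2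
  obtain ⟨-, -, -, -, hQ⟩ := hT u hu
  generalize (∫ v in (0:ℝ)..u, Real.exp (-(θ * κ * (u - v))) *
      |-(wp v) ^ 2 + (wl v) ^ 2 - εb * bp v * wp v|) = Ia at hm0le hint
  generalize (∫ v in (0:ℝ)..u, wp v ^ 2) = Iq at hQ hint
  have hu10 : u ≤ 10 := hu.2.trans (hs.2.trans hT10)
  have h1 := mul_le_mul_of_nonneg_left hint hκ.le
  have hκu : κ * u ≤ 10 := by nlinarith only [hκ1, hu10, hκ, hu.1]
  nlinarith only [hA, hm0le, h1, hQ, hκu]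

/-- **Carrier forcing.** `G = κ(wl² - εb bp wp) + e0` obeys
`|G| ≤ κ(ω² + η(μ+3)) + (9/20) κ εb (1 + wp²)` on `[0, s]`. [folklore] -/
theorem prevPair_G_le {u : ℝ} (hu : u ∈ Icc 0 s) :
    |κ * (wl u ^ 2 - εb * bp u * wp u) + e0 u| ≤
      κ * (ω ^ 2 + η * (μ + 3)) + 9 / 20 * κ * εb * (1 + wp u ^ 2) := by
  have hm0 := prevPair_m0 hκq hsm hBT hΛ hcont hode herr henv hini hs hT hu
  obtain ⟨hκ0, -, -, -⟩ := hκq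
  obtain ⟨hη, hεb, -, -, -, -, -, -, -⟩ := hsm
  obtain ⟨he0, -, -, -⟩ := herr
  obtain ⟨hwl, -, -⟩ := henv
  have hκ : 0 < κ := by linarith
  have huT : u ∈ Icc 0 T := ⟨hu.1, hu.2.trans hs.2⟩
  obtain ⟨hbp1, hbp2, -, -, -⟩ := hT u hu
  have hwlu := hwl u huT
  have h1 : |κ * (wl u ^ 2 - εb * bp u * wp u)| ≤ κ * (wl u ^ 2 + εb * |bp u| * |wp u|) := by
    rw [abs_mul, abs_of_pos hκ]
    refine mul_le_mul_of_nonneg_left ?_ hκ.le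
    have hx : |εb * bp u * wp u| = εb * |bp u| * |wp u| := by
      rw [abs_mul, abs_mul, abs_of_pos hεb]
    rw [abs_le]
    constructor <;> nlinarith only [neg_abs_le (εb * bp u * wp u), le_abs_self (εb * bp u * wp u),
      hx, sq_nonneg (wl u)]
  have h2 : wl u ^ 2 ≤ ω ^ 2 := by nlinarith only [abs_le.1 hwlu, sq_abs (wl u)]
  have h3 : |bp u| ≤ 9 / 10 := abs_le.2 ⟨by linarith only [hbp1], hbp2⟩
  have h4 : |wp u| ≤ (1 + wp u ^ 2) / 2 := by
    nlinarith only [sq_nonneg (|wp u| - 1), sq_abs (wp u)]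
  have h5 : εb * |bp u| * |wp u| ≤ εb * (9 / 10) * ((1 + wp u ^ 2) / 2) :=
    mul_le_mul (mul_le_mul_of_nonneg_left h3 hεb.le) h4 (abs_nonneg _) (by positivity)
  have h6 : |e0 u| ≤ κ * (η * (μ + 3)) := by
    refine (he0 u huT).trans ?_
    have := mul_le_mul_of_nonneg_left hm0 (mul_nonneg hη hκ.le)
    nlinarith only [this]
  calc _ ≤ |κ * (wl u ^ 2 - εb * bp u * wp u)| + |e0 u| := abs_add_le _ _
    _ ≤ κ * (wl u ^ 2 + εb * |bp u| * |wp u|) + κ * (η * (μ + 3)) := add_le_add h1 h6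
    _ ≤ _ := by nlinarith only [mul_le_mul_of_nonneg_left h2 hκ.le,
        mul_le_mul_of_nonneg_left h5 hκ.le]

/-- **Duhamel for the carrier.** With the weighted dump `I₁(σ) = ∫₀^σ e^{κu} κ wp(u)² du`:
`|bp(σ) - e^{-κσ}(bp(0) - I₁(σ))| ≤ 7/125` on `[0, s]` (the inflow `wl² ≤ ω²`, the memory error
`|e0| ≤ ηκ(μ+3)` and the cross term `εb bp wp`, integrated). [folklore] -/
theorem prevPair_bp_duhamel {σ : ℝ} (hσ : σ ∈ Icc 0 s) :
    |bp σ - Real.exp (-(κ * σ)) *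
        (bp 0 - ∫ u in (0:ℝ)..σ, Real.exp (κ * u) * (κ * wp u ^ 2))| ≤ 7 / 125 := by
  obtain ⟨-, -, hwpc, hbpc⟩ := prevPair_cont hκq hsm hBT hΛ hcont hode herr henv hini hs hT
  have hGle := fun (u : ℝ) (hu : u ∈ Icc 0 s) =>
    prevPair_G_le hκq hsm hBT hΛ hcont hode herr henv hini hs hT hu
  obtain ⟨-, -, hηω⟩ := prevPair_consts hκq hsm hBT hΛ hcont hode herr henv hini hs hT
  obtain ⟨hκ0, hκ1, -, -⟩ := hκq
  obtain ⟨hη, hεb, hεω, hω, hμ, -, hημ, -, -⟩ := hsm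
  obtain ⟨-, -, -, -, hT10⟩ := hBT
  have hκ : 0 < κ := by linarith
  have hsubT : Icc 0 s ⊆ Icc 0 T := Icc_subset_Icc_right hs.2
  have hwlc : ContinuousOn wl (Icc 0 s) := hcont.2.2.2.2.2.1.mono hsubT
  have he0c : ContinuousOn e0 (Icc 0 s) := hcont.2.2.2.2.2.2.1.mono hsubT
  -- Duhamel
  have hGc : ContinuousOn (fun u => κ * (wl u ^ 2 - εb * bp u * wp u) + e0 u) (Icc 0 s) :=
    (continuousOn_const.mul ((hwlc.pow 2).sub ((continuousOn_const.mul hbpc).mul hwpc))).add he0c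
  have hgc : ContinuousOn (fun u => -(κ * wp u ^ 2) +
      (κ * (wl u ^ 2 - εb * bp u * wp u) + e0 u)) (Icc 0 s) :=
    (continuousOn_const.mul (hwpc.pow 2)).neg.add hGc
  have hd : ∀ t ∈ Ioo 0 s, HasDerivAt bp (-(κ * bp t) +
      (-(κ * wp t ^ 2) + (κ * (wl t ^ 2 - εb * bp t * wp t) + e0 t))) t :=
    fun t ht => (hode.1 t ⟨ht.1, ht.2.trans_le hs.2⟩).congr_deriv (by ring)
  have hD := previousPair_duhamel hs.1 hbpc hgc hd hσ
  -- split the Duhamel integral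
  have hsub : Icc 0 σ ⊆ Icc 0 s := Icc_subset_Icc_right hσ.2
  have hEc : ContinuousOn (fun u => Real.exp (κ * u)) (Icc 0 σ) :=
    Continuous.continuousOn (by fun_prop)
  have hI1i : IntervalIntegrable (fun u => -(Real.exp (κ * u) * (κ * wp u ^ 2))) volume 0 σ :=
    (hEc.mul (continuousOn_const.mul ((hwpc.mono hsub).pow 2))).neg.intervalIntegrable_of_Icc
      hσ.1
  have hIGi : IntervalIntegrable (fun u => Real.exp (κ * u) *
      (κ * (wl u ^ 2 - εb * bp u * wp u) + e0 u)) volume 0 σ :=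
    (hEc.mul (hGc.mono hsub)).intervalIntegrable_of_Icc hσ.1
  have hsplit : ∫ u in (0:ℝ)..σ, Real.exp (κ * u) * (-(κ * wp u ^ 2) +
      (κ * (wl u ^ 2 - εb * bp u * wp u) + e0 u)) =
      -(∫ u in (0:ℝ)..σ, Real.exp (κ * u) * (κ * wp u ^ 2)) +
        ∫ u in (0:ℝ)..σ, Real.exp (κ * u) * (κ * (wl u ^ 2 - εb * bp u * wp u) + e0 u) := by
    rw [← intervalIntegral.integral_neg, ← intervalIntegral.integral_add hI1i hIGi]
    exact intervalIntegral.integral_congr fun u _ => by ring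
  rw [hsplit] at hD
  -- bound the forcing integral
  have hpt : ∀ u ∈ Icc 0 σ, |Real.exp (κ * u) * (κ * (wl u ^ 2 - εb * bp u * wp u) + e0 u)| ≤
      Real.exp ((u - 0) * κ) * (κ * (ω ^ 2 + η * (μ + 3))) +
        Real.exp (κ * σ) * (9 / 20 * κ * εb) * (1 + wp u ^ 2) := by
    intro u hu
    rw [abs_mul, abs_of_pos (Real.exp_pos _)]
    have hG := hGle u (hsub hu)
    have hE1 : Real.exp (κ * u) ≤ Real.exp (κ * σ) :=
      Real.exp_le_exp.2 (mul_le_mul_of_nonneg_left hu.2 hκ.le)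
    have hE2 : Real.exp ((u - 0) * κ) = Real.exp (κ * u) := by ring_nf
    rw [hE2]
    have h0 : 0 ≤ 9 / 20 * κ * εb * (1 + wp u ^ 2) := by positivity
    nlinarith only [mul_le_mul_of_nonneg_left hG (Real.exp_pos (κ * u)).le,
      mul_le_mul_of_nonneg_right hE1 h0]
  have hwI : IntervalIntegrable (fun u => wp u ^ 2) volume 0 σ :=
    ((hwpc.mono hsub).pow 2).intervalIntegrable_of_Icc hσ.1
  have hJ1 : IntervalIntegrable (fun u => Real.exp ((u - 0) * κ) * (κ * (ω ^ 2 + η * (μ + 3))))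
      volume 0 σ := (Continuous.continuousOn (by fun_prop)).intervalIntegrable_of_Icc hσ.1
  have hJ2 : IntervalIntegrable (fun u => Real.exp (κ * σ) * (9 / 20 * κ * εb) * (1 + wp u ^ 2))
      volume 0 σ := (intervalIntegrable_const.add hwI).const_mul _
  have hmono := intervalIntegral.integral_mono_on hσ.1 (hIGi.abs) (hJ1.add hJ2) hpt
  have habs := intervalIntegral.abs_integral_le_integral_abs
    (f := fun u => Real.exp (κ * u) * (κ * (wl u ^ 2 - εb * bp u * wp u) + e0 u))
    (μ := volume) hσ.1
  rw [intervalIntegral.integral_add hJ1 hJ2, linearComparison_integral_exp,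
    intervalIntegral.integral_const_mul, intervalIntegral.integral_add intervalIntegrable_const
    hwI, intervalIntegral.integral_const, smul_eq_mul, mul_one, sub_zero] at hmono
  obtain ⟨-, -, -, -, hQ⟩ := hT σ hσ
  -- collect
  generalize (∫ u in (0:ℝ)..σ, Real.exp (κ * u) *
      (κ * (wl u ^ 2 - εb * bp u * wp u) + e0 u)) = IG at hD hmono habs
  generalize (∫ u in (0:ℝ)..σ, |Real.exp (κ * u) *
      (κ * (wl u ^ 2 - εb * bp u * wp u) + e0 u)|) = IA at hmono habs
  generalize (∫ u in (0:ℝ)..σ, Real.exp (κ * u) * (κ * wp u ^ 2)) = I1 at hD ⊢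
  generalize (∫ u in (0:ℝ)..σ, wp u ^ 2) = Iq at hQ hmono
  have hEσ : Real.exp (-(κ * σ)) * Real.exp (σ * κ) = 1 := by
    rw [← Real.exp_add]; ring_nf; exact Real.exp_zero
  have hEσ' : Real.exp (-(κ * σ)) * Real.exp (κ * σ) = 1 := by
    rw [← Real.exp_add]; ring_nf; exact Real.exp_zero
  have hEpos := Real.exp_pos (-(κ * σ))
  have hEle : Real.exp (-(κ * σ)) ≤ 1 :=
    Real.exp_le_one_iff.2 (by nlinarith only [hκ, hσ.1])
  have heq : bp σ - Real.exp (-(κ * σ)) * (bp 0 - I1) = Real.exp (-(κ * σ)) * IG := by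
    rw [hD]; ring
  rw [heq, abs_mul, abs_of_pos hEpos]
  -- numerical budget
  have hσ10 : σ ≤ 10 := hσ.2.trans (hs.2.trans hT10)
  have hκσ : κ * σ ≤ 10 := by nlinarith only [hκ1, hσ10, hκ, hσ.1]
  have hε : εb ≤ 1 / 1000 := by linarith only [hεω, hω]
  have hg0 : ω ^ 2 + η * (μ + 3) ≤ 502 / 10000 := by nlinarith only [hω, hημ, hηω, hεb, hεω]
  have hcross : 9 / 20 * κ * εb * (σ + Iq) ≤ 5 / 1000 := by
    have : 9 / 20 * κ * εb * (σ + Iq) = 9 / 20 * εb * (κ * σ + κ * Iq) := by ring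
    rw [this]
    nlinarith only [hκσ, hQ, hε, hεb]
  have key : Real.exp (-(κ * σ)) * IA ≤ 7 / 125 := by
    have h1 := mul_le_mul_of_nonneg_left hmono hEpos.le
    have h2 : Real.exp (-(κ * σ)) * ((ω ^ 2 + η * (μ + 3)) * (Real.exp (σ * κ) - 1) +
        Real.exp (κ * σ) * (9 / 20 * κ * εb) * (σ + Iq)) =
        (ω ^ 2 + η * (μ + 3)) * (1 - Real.exp (-(κ * σ))) + 9 / 20 * κ * εb * (σ + Iq) := by
      linear_combination (ω ^ 2 + η * (μ + 3)) * hEσ + 9 / 20 * κ * εb * (σ + Iq) * hEσ'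
    rw [h2] at h1
    have h3 : (ω ^ 2 + η * (μ + 3)) * (1 - Real.exp (-(κ * σ))) ≤ 502 / 10000 := by
      have hg0' : 0 ≤ ω ^ 2 + η * (μ + 3) := by positivity
      nlinarith only [hg0, hg0', hEle, hEpos]
    linarith only [h1, h3, hcross]
  exact (mul_le_mul_of_nonneg_left habs hEpos.le).trans key

/-- **Carrier upper bound.** `bp ≤ 77/100` on `[0, s]` (`bp ≤ e^{-κσ} bp(0) + 7/125`,
`bp(0) ≤ q⁴/2 + 1/10 ≤ 0.708`). [folklore] -/
theorem prevPair_bp_upper {σ : ℝ} (hσ : σ ∈ Icc 0 s) : bp σ ≤ 77 / 100 := by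
  obtain ⟨-, -, hwpc, -⟩ := prevPair_cont hκq hsm hBT hΛ hcont hode herr henv hini hs hT
  have hD := prevPair_bp_duhamel hκq hsm hBT hΛ hcont hode herr henv hini hs hT hσ
  obtain ⟨hκ0, -, hq1, hq2⟩ := hκq
  obtain ⟨hbp0l, hbp0u, -, -, -, -, -⟩ := hini
  have hκ : 0 < κ := by linarith
  have hI1 : 0 ≤ ∫ u in (0:ℝ)..σ, Real.exp (κ * u) * (κ * wp u ^ 2) :=
    intervalIntegral.integral_nonneg hσ.1 fun u _ => by positivity
  generalize (∫ u in (0:ℝ)..σ, Real.exp (κ * u) * (κ * wp u ^ 2)) = I1 at hD hI1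
  have hE := Real.exp_pos (-(κ * σ))
  have hEle : Real.exp (-(κ * σ)) ≤ 1 := Real.exp_le_one_iff.2 (by nlinarith only [hκ, hσ.1])
  have hq4 : q ^ 4 ≤ 194481 / 160000 := by
    have := pow_le_pow_left₀ (by linarith only [hq1]) hq2 4
    norm_num at this
    exact this
  have hbp0 : 0 ≤ bp 0 := by nlinarith only [hbp0l, one_le_pow₀ (M₀ := ℝ) hq1 (n := 4)]
  have h1 : Real.exp (-(κ * σ)) * (bp 0 - I1) ≤ bp 0 := by
    nlinarith only [hE, hEle, hI1, hbp0]
  linarith only [(abs_le.1 hD).2, h1, hbp0u, hq4]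

end Tube

/-- **Registered sub-goal `stub_prevPairCarrier`** (stub `previousPair`, line `Sketch`):
inside the bootstrap tube on `[0, s]`, the previous carrier obeys `bp ≤ 77/100`. [folklore] -/
theorem stub_prevPairCarrier :
    ∀ (bp wp b m0 m1 wl e0 e1 : ℝ → ℝ) (B Λ κ q θ η εb ω μ σI T s : ℝ),
      (4 / 5 ≤ κ ∧ κ ≤ 1 ∧ 1 ≤ q ∧ q ≤ 21 / 20) →
      (0 ≤ η ∧ 0 < εb ∧ 10 * εb ≤ ω ∧ ω ≤ 1 / 100 ∧ 0 ≤ μ ∧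
        η * (μ + 2 * Real.sqrt B) ≤ ω / 10 ∧ η * μ ≤ 1 / 20 ∧ 1 / 2 ≤ θ ∧ θ ≤ 1) →
      (1000 ≤ B ∧ 0 < σI ∧ σI ≤ 3 ∧ 0 < T ∧ T ≤ 10) →
      (100 ≤ Λ ∧ Λ ≤ B * (1 - Real.exp (-σI)) ∧
        11 * Real.sqrt B * Real.exp (-(κ * Λ / 3)) ≤ ω) →
      (ContinuousOn bp (Icc 0 T) ∧ ContinuousOn wp (Icc 0 T) ∧ ContinuousOn b (Icc 0 T) ∧
        ContinuousOn m0 (Icc 0 T) ∧ ContinuousOn m1 (Icc 0 T) ∧ ContinuousOn wl (Icc 0 T) ∧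
        ContinuousOn e0 (Icc 0 T) ∧ ContinuousOn e1 (Icc 0 T)) →
      ((∀ σ ∈ Ioo 0 T, HasDerivAt bp
          (κ * (-(bp σ) - (wp σ) ^ 2 + (wl σ) ^ 2 - εb * bp σ * wp σ) + e0 σ) σ) ∧
        (∀ σ ∈ Ioo 0 T, HasDerivAt wp
          (κ * (wp σ * (bp σ - b σ / q - 1) + εb * (bp σ) ^ 2) + e1 σ) σ)) →
      ((∀ σ ∈ Icc 0 T, |e0 σ| ≤ η * κ * m0 σ) ∧ (∀ σ ∈ Icc 0 T, |e1 σ| ≤ η * κ * m1 σ) ∧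
        (∀ σ ∈ Icc 0 T, 0 ≤ m0 σ ∧ m0 σ ≤ m0 0 * Real.exp (-(θ * κ * σ)) +
          κ * ∫ u in (0 : ℝ)..σ, Real.exp (-(θ * κ * (σ - u))) *
            |-(wp u) ^ 2 + (wl u) ^ 2 - εb * bp u * wp u|) ∧
        (∀ σ ∈ Icc 0 T, 0 ≤ m1 σ ∧ m1 σ ≤ m1 0 * Real.exp (-(θ * κ * σ)) +
          κ * ∫ u in (0 : ℝ)..σ, Real.exp (-(θ * κ * (σ - u))) *
            |wp u * (bp u - b u / q) + εb * (bp u) ^ 2|)) →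
      ((∀ σ ∈ Icc 0 T, |wl σ| ≤ ω) ∧
        (∀ σ ∈ Icc 0 (min T σI), B * Real.exp (-σ) - 3 ≤ b σ) ∧
        (∀ σ ∈ Icc 0 T, -(1 / 2) ≤ b σ ∧ b σ ≤ B + 3)) →
      (q ^ 4 / 2 - 3 / 20 ≤ bp 0 ∧ bp 0 ≤ q ^ 4 / 2 + 1 / 10 ∧ 0 ≤ wp 0 ∧
        q ^ 3 * B - 1 ≤ (wp 0) ^ 2 ∧ (wp 0) ^ 2 ≤ q ^ 3 * B + 1 ∧ m0 0 ≤ μ ∧ m1 0 ≤ μ) →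
      (s ∈ Icc 0 T) →
      (∀ σ ∈ Icc 0 s, -(1 / 2) ≤ bp σ ∧ bp σ ≤ 9 / 10 ∧ (σ ≤ σI ∨ bp σ ≤ 2 / 5) ∧
        m1 σ ≤ μ + 3 * Real.sqrt B ∧ κ * ∫ u in (0 : ℝ)..σ, (wp u) ^ 2 ≤ 1) →
      ∀ σ ∈ Icc 0 s, bp σ ≤ 77 / 100 :=
  fun _ _ _ _ _ _ _ _ _ _ _ _ _ _ _ _ _ _ _ _ hκq hsm hBT hΛ hcont hode herr henv hini hs hT _ hσ =>
    prevPair_bp_upper hκq hsm hBT hΛ hcont hode herr henv hini hs hT hσ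

end Summit.NavierStokesRegularity.NavierStokesRegularity.Theorems.PerpetualPumpAveragedTypeIBlowup

end
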